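import Mathlib
import Literature.Barriers.ValiantsHypothesis.AlgebraicNaturalProofs
import Literature.Computability.AlgebraicComplexity.ArithCircuitProofs
import Summits.ValiantsHypothesis.ValiantsHypothesis.Theorems.BarrierLeverNaturalProofsAgainstAllLinearSizesOfCountSize

/-!
# Route BarrierLever — TEMPLATE: coordinate rank methods are algebraically natural proofs with
# `q = 0` (the reusable half of every "model-axis" slice of crux `DefinableEquations`, stmt-8745 /
# item `SingleSizeEquations`, stmt-8749; val-np-p5 g8)

The model axis of the crux (g3–g4: Kalorkoti for formulas, Nisan for ROABPs, dimension counts for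
`ΣΛΣ` / `ΣΠΣ`) and the recommended next slice (constant product-depth circuits via the tree's
Limaye–Srinivasan–Tavenas engine `LSTWord.relRank_aeval_eval_le`, whose measure is the rank of a
matrix of COEFFICIENTS of a renamed polynomial) all end the same way: a square matrix whose
entries are coefficient COORDINATES `c_{T i j}` has rank `< r` on the class, and its determinant
is the distinguisher.  This file proves that last step once and for all, for an arbitrary
placement `T : Fin r × Fin r → degLEMonomials n` of `r²` DISTINCT coordinates:

* `det_ne_zero` — the coordinate determinant `det (c_{T i j})` is a NONZERO polynomial
  (evaluate at the point with `1` on the diagonal coordinates: injectivity of `T` makes the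
  numerical matrix the identity) — no hard instance of the class is needed for non-vanishing;
* `eval_det_eq_zero_of_rank_lt` — it vanishes at every `c` whose numerical matrix `(c (T i j))`
  has rank `< r` (`Matrix.rank_of_isUnit`);
* `complexity_det_le` (`≤ 8(r+1)^7`, Berkowitz via the tree's
  `NaturalProofsAgainstAllLinearSizes.complexity_det_le`), `totalDegree_det_le` (`≤ r`),
  `det_mem_distinguishers` (`8(r+1)^7 ≤ N^a ⇒ ∈ Distinguishers ℂ n a`);
* **`isNaturalProof_det`** — if every `f ∈ 𝒞` has `rank (coeff_{T i j} f)_{i,j} < r` and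
  `8(r+1)^7 ≤ C(2n,n)^a`, the coordinate determinant is an FSV natural proof against `𝒞` from
  `Distinguishers ℂ n a`; `not_isSuccinctHittingSet_of_rank_lt` (FSV Thm. 4 form) and
  `exists_boolSum_of_rank_lt` (the crux's `Eq(n,·,a)` shape with `q = 0` Boolean variables).

To instantiate a rank method: give `T` (injective) and the rank bound on the class; e.g. for the
LST slice, `T` enumerates a square block of the coefficient matrix `coeffMat A B` of the
word-renamed polynomial and the bound is `LSTWord.relRank_aeval_eval_le` + `Matrix.rank` of a
submatrix.  What this is NOT: no new slice is proved here; nothing bears on the crux's verdict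
(b = 2 OPEN) or on `VP ≠ VNP`.  No definitions, no named facts; standard axioms.
-/

-- `Summit.ValiantsHypothesis.ValiantsHypothesis.…` repeats a component by the D-0017 layout
-- (single-conjunct summit), which the `dupNamespace` linter flags; the name is mandated.
set_option linter.dupNamespace false

noncomputable section

namespace Summit.ValiantsHypothesis.ValiantsHypothesis.Theorems.BarrierLeverDefinableEquations

open MvPolynomial
open Literature.Computability.AlgebraicComplexity Literature.Barriers.ValiantsHypothesis
open scoped BigOperators

namespace RankTemplate

variable {n r : ℕ}

/-! ## §1 The coordinate determinant of a placement `T : Fin r × Fin r → coordinates` -/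

/-- Evaluating the coordinate determinant `det (c_{T i j})_{i,j}` at a point `c` gives the
determinant of the numerical matrix `(c (T i j))`. [folklore] -/
theorem eval_det (T : Fin r → Fin r → ↥(degLEMonomials n)) (c : ↥(degLEMonomials n) → ℂ) :
    eval c (Matrix.of fun i j => (X (T i j) : MvPolynomial ↥(degLEMonomials n) ℂ)).det =
      (Matrix.of fun i j => c (T i j)).det := by
  rw [RingHom.map_det]
  congr 1
  ext i j
  simp [RingHom.mapMatrix_apply, Matrix.map_apply]

/-- **Non-vanishing for free**: if the placement `T` is injective (all `r²` entries are DISTINCT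
coordinate variables) then the coordinate determinant is a nonzero polynomial — evaluate at the
point putting `1` on the diagonal coordinates and `0` elsewhere. [folklore] -/
theorem det_ne_zero (T : Fin r → Fin r → ↥(degLEMonomials n))
    (hT : Function.Injective (Function.uncurry T)) :
    (Matrix.of fun i j => (X (T i j) : MvPolynomial ↥(degLEMonomials n) ℂ)).det ≠ 0 := by
  classical
  intro h
  set c : ↥(degLEMonomials n) → ℂ := fun μ => if ∃ i, T i i = μ then 1 else 0 with hc
  have hmat : (Matrix.of fun i j => c (T i j)) = 1 := by
    ext i j
    simp only [Matrix.of_apply, Matrix.one_apply, hc]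
    by_cases hij : i = j
    · subst hij; simp
    · rw [if_neg hij, if_neg]
      rintro ⟨i', hi'⟩
      have := hT (a₁ := (i', i')) (a₂ := (i, j)) hi'
      simp only [Prod.mk.injEq] at this
      exact hij (this.1 ▸ this.2)
  have h2 := eval_det T c
  rw [h, map_zero, hmat, Matrix.det_one] at h2
  exact zero_ne_one h2

/-- **Vanishing from a rank bound**: if the numerical matrix `(c (T i j))` has rank `< r` then
the coordinate determinant vanishes at `c`. [folklore] -/
theorem eval_det_eq_zero_of_rank_lt (T : Fin r → Fin r → ↥(degLEMonomials n))
    (c : ↥(degLEMonomials n) → ℂ) (h : (Matrix.of fun i j => c (T i j)).rank < r) :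
    eval c (Matrix.of fun i j => (X (T i j) : MvPolynomial ↥(degLEMonomials n) ℂ)).det = 0 := by
  rw [eval_det]
  by_contra hne
  have hu : IsUnit (Matrix.of fun i j => c (T i j)) :=
    (Matrix.isUnit_iff_isUnit_det _).mpr (isUnit_iff_ne_zero.mpr hne)
  have hr := Matrix.rank_of_isUnit _ hu
  rw [Fintype.card_fin] at hr
  omega

/-- Size of the coordinate determinant: `≤ 8 (r+1)^7` (Berkowitz, tree
`NaturalProofsAgainstAllLinearSizes.complexity_det_le`). [folklore] -/
theorem complexity_det_le (T : Fin r → Fin r → ↥(degLEMonomials n)) :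
    complexity (Matrix.of fun i j => (X (T i j) : MvPolynomial ↥(degLEMonomials n) ℂ)).det ≤
      8 * (r + 1) ^ 7 := by
  have h := BarrierLever.NaturalProofsAgainstAllLinearSizes.complexity_det_le
    (Matrix.of fun i j => (X (T i j) : MvPolynomial ↥(degLEMonomials n) ℂ)) 0
    (fun i j => by rw [Matrix.of_apply, complexity_X_holds])
  simpa [Fintype.card_fin] using h

/-- Degree of the coordinate determinant: `≤ r`. [folklore] -/
theorem totalDegree_det_le (T : Fin r → Fin r → ↥(degLEMonomials n)) :
    (Matrix.of fun i j => (X (T i j) : MvPolynomial ↥(degLEMonomials n) ℂ)).det.totalDegree ≤ r := by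
  have h := BarrierLever.NaturalProofsAgainstAllLinearSizes.totalDegree_det_le_card
    (Matrix.of fun i j => (X (T i j) : MvPolynomial ↥(degLEMonomials n) ℂ))
    (fun i j => by rw [Matrix.of_apply, totalDegree_X])
  simpa [Fintype.card_fin] using h

/-! ## §2 FSV packaging: any coordinate rank method is a `q = 0` natural proof -/

/-- Level bookkeeping: `8 (r+1)^7 ≤ N^a` gives both bounds of `Distinguishers ℂ n a`. [folklore] -/
theorem det_mem_distinguishers (T : Fin r → Fin r → ↥(degLEMonomials n)) {a : ℕ}
    (hr : 8 * (r + 1) ^ 7 ≤ Nat.choose (2 * n) n ^ a) :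
    (Matrix.of fun i j => (X (T i j) : MvPolynomial ↥(degLEMonomials n) ℂ)).det ∈
      Distinguishers ℂ n a := by
  refine ⟨(complexity_det_le T).trans hr, (totalDegree_det_le T).trans (le_trans ?_ hr)⟩
  calc r ≤ r + 1 := Nat.le_succ r
    _ ≤ (r + 1) ^ 7 := Nat.le_self_pow (by norm_num) _
    _ ≤ 8 * (r + 1) ^ 7 := Nat.le_mul_of_pos_left _ (by norm_num)

/-- **TEMPLATE (coordinate rank methods are algebraically natural, `q = 0`).**  Let
`T : Fin r × Fin r → degLEMonomials n` place `r²` DISTINCT coefficient coordinates in a square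
grid, and suppose every `f` in a class `𝒞` makes the numerical matrix `(coeff_{T i j} f)` have
rank `< r`.  Then the coordinate determinant `det (c_{T i j})` is an FSV natural proof against
`𝒞` from `Distinguishers ℂ n a` as soon as `8(r+1)^7 ≤ N^a` (`N = C(2n,n)`): nonzero (§1), of
size `≤ 8(r+1)^7` and degree `≤ r`, vanishing on `coeff(𝒞)`.  Intended use: rank methods whose
matrix entries are coefficients of `f` at prescribed monomials (Nisan cuts, coefficient
matrices of set-multilinear projections as in Limaye–Srinivasan–Tavenas, partial-derivative
coefficient matrices) — supply `T` and the rank bound. [cite: ForbesShpilkaVolk2018, Def. 1] -/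
theorem isNaturalProof_det (T : Fin r → Fin r → ↥(degLEMonomials n))
    (hT : Function.Injective (Function.uncurry T)) {𝒞 : Set (MvPolynomial (Fin n) ℂ)}
    (hrank : ∀ f ∈ 𝒞, (Matrix.of fun i j => coeff (T i j : Fin n →₀ ℕ) f).rank < r)
    {a : ℕ} (hr : 8 * (r + 1) ^ 7 ≤ Nat.choose (2 * n) n ^ a) :
    IsNaturalProof (degLEMonomials n) 𝒞 (Distinguishers ℂ n a)
      (Matrix.of fun i j => (X (T i j) : MvPolynomial ↥(degLEMonomials n) ℂ)).det := by
  refine ⟨det_mem_distinguishers T hr, det_ne_zero T hT, fun f hf => ?_⟩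
  refine eval_det_eq_zero_of_rank_lt T _ ?_
  have : (Matrix.of fun i j => coeffVector (degLEMonomials n) f (T i j)) =
      Matrix.of fun i j => coeff (T i j : Fin n →₀ ℕ) f := by
    ext i j; rw [Matrix.of_apply, Matrix.of_apply, coeffVector_apply]
  rw [this]
  exact hrank f hf

/-- Hitting-set form of the template: under the same hypotheses `𝒞` is NOT a succinct hitting
set for `Distinguishers ℂ n a` (FSV Thm. 4). [cite: ForbesShpilkaVolk2018, Thm. 4] -/
theorem not_isSuccinctHittingSet_of_rank_lt (T : Fin r → Fin r → ↥(degLEMonomials n))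
    (hT : Function.Injective (Function.uncurry T)) {𝒞 : Set (MvPolynomial (Fin n) ℂ)}
    (hrank : ∀ f ∈ 𝒞, (Matrix.of fun i j => coeff (T i j : Fin n →₀ ℕ) f).rank < r)
    {a : ℕ} (hr : 8 * (r + 1) ^ 7 ≤ Nat.choose (2 * n) n ^ a) :
    ¬ IsSuccinctHittingSet (degLEMonomials n) 𝒞 (Distinguishers ℂ n a) := by
  rw [← exists_isNaturalProof_iff]
  exact ⟨_, isNaturalProof_det T hT hrank hr⟩

/-- Equation form for the crux's inner statement with `q = 0`: under the same hypotheses there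
is `H` (on the coefficient variables and NO Boolean variables) with `L(H), deg H ≤ N^a`,
`boolSum H ≠ 0` vanishing on `coeff(𝒞)` — the shape of `Eq(n, ·, a)` for the class `𝒞`.
[cite: ForbesShpilkaVolk2018, Def. 1] -/
theorem exists_boolSum_of_rank_lt (T : Fin r → Fin r → ↥(degLEMonomials n))
    (hT : Function.Injective (Function.uncurry T)) {𝒞 : Set (MvPolynomial (Fin n) ℂ)}
    (hrank : ∀ f ∈ 𝒞, (Matrix.of fun i j => coeff (T i j : Fin n →₀ ℕ) f).rank < r)
    {a : ℕ} (hr : 8 * (r + 1) ^ 7 ≤ Nat.choose (2 * n) n ^ a) :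
    ∃ q : ℕ, q ≤ Nat.choose (2 * n) n ^ a ∧
      ∃ H : MvPolynomial (↥(degLEMonomials n) ⊕ Fin q) ℂ,
        complexity H ≤ Nat.choose (2 * n) n ^ a ∧ H.totalDegree ≤ Nat.choose (2 * n) n ^ a ∧
        boolSum H ≠ 0 ∧ ∀ f ∈ 𝒞, eval (coeffVector (degLEMonomials n) f) (boolSum H) = 0 := by
  obtain ⟨hD, hne, hvan⟩ := isNaturalProof_det T hT hrank hr
  set D := (Matrix.of fun i j => (X (T i j) : MvPolynomial ↥(degLEMonomials n) ℂ)).det with hDdef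
  -- the empty Boolean sum of `rename inl D` is `D` (as in `SingleSizeEquations.boolSum_rename_inl`
  -- of the route cone, inlined to keep this file route-independent)
  have hbs : boolSum (m := 0) (MvPolynomial.rename Sum.inl D) = D := by
    rw [boolSum, Fintype.sum_unique, MvPolynomial.aeval_rename, Sum.elim_comp_inl,
      MvPolynomial.aeval_X_left, AlgHom.coe_id, id_eq]
  refine ⟨0, Nat.zero_le _, MvPolynomial.rename Sum.inl D, ?_, ?_, ?_, ?_⟩
  · exact (complexity_rename_le_holds' _ _).trans hD.1
  · exact (MvPolynomial.totalDegree_rename_le _ _).trans hD.2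
  · rwa [hbs]
  · intro f hf; rw [hbs]; exact hvan f hf

end RankTemplate

end Summit.ValiantsHypothesis.ValiantsHypothesis.Theorems.BarrierLeverDefinableEquations
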